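import Mathlib
import Summits.Schanuel.Schanuel.Theorems.DiophantineDichotomyDefs
import HarnessLib

/-!
# Route `DiophantineDichotomy`, crux `KhovanskiiApproxTypeEv` (stmt-Schanuel-14972), line `lambert-liouville-kill`:
# stub `stub_anchoredPoint` — the anchored free Khovanskii point `(1, iπ, x)`, `k x eˣ = 1`

Crux `Summit.Schanuel.Schanuel.Theses.DiophantineDichotomy.KhovanskiiApproxTypeEv` (item stmt-Schanuel-14972),
certificate line `lambert-liouville-kill` (skeleton `Cruxes/KhovanskiiApproxTypeEv/Lines/lambert_liouville_kill.lean`,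
lead `prover-line-stmt-Schanuel-14972-a1-0`), registered stub `stub_anchoredPoint` (landed `--supports stmt-Schanuel-14972`).

STUB 7 of the line: the rank-3 (anchored) certificate `notLiouville_lambert_of_evAnchored` runs at the point
`s = (1, iπ, x) ∈ ℂ³` where `x = W(1/k) > 0` is a Lambert number (`k ≥ 1`, `k x eˣ = 1`, `x` irrational).
This file proves the two hypotheses the anchored restatement of the crux charges at `s`:
* `s` is a FREE KHOVANSKII POINT (`IsFreeKhovanskii 3 s`, tree def
  `Summit.Schanuel.Schanuel.Cruxes.KhovanskiiApproxType.LwSmallHeight.IsFreeKhovanskii`): the Khovanskii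
  system `z₀ − 1 = 0`, `y₁ + 1 = 0` (`e^{iπ} = −1`), `k z₂ y₂ − 1 = 0` (`k x eˣ = 1`) over `ℚ` vanishes at
  `(s, e^s)` and its exponential Jacobian `(∂gᵢ/∂zⱼ + yⱼ ∂gᵢ/∂yⱼ)` is `diag(1, −1, k eˣ (1 + x))`, of
  determinant `−k eˣ (1 + x) ≠ 0`;
* `(1, iπ, x)` is `ℚ`-linearly independent: a rational relation `g₀ + g₁ iπ + g₂ x = 0` has imaginary
  part `g₁ π = 0`, then real part `g₀ + g₂ x = 0` with `x ∉ ℚ`.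
-/

noncomputable section

-- `Summit.Schanuel.Schanuel.…` is the mandated summit/sub-problem namespace (single-conjunct summit), hence:
set_option linter.dupNamespace false

namespace Summit.Schanuel.Schanuel.Cruxes.KhovanskiiApproxTypeEv.LambertLiouvilleKill

open Summit.Schanuel.Schanuel.Cruxes.KhovanskiiApproxType.LwSmallHeight (IsFreeKhovanskii)
open Polynomial

/-- `s = (1, iπ, x)` with `k x eˣ = 1`, `k ≥ 1`, `x > 0` is a FREE KHOVANSKII POINT of `ℂ³`: the system
`z₀ − 1 = 0`, `y₁ + 1 = 0`, `k z₂ y₂ − 1 = 0` over `ℚ` vanishes at `(s, e^s)` (`e^{iπ} = −1`) and has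
exponential Jacobian `diag(1, y₁, k y₂ (1 + z₂)) = diag(1, −1, k eˣ (1 + x))`, of determinant
`−k eˣ (1 + x) ≠ 0`. [folklore] -/
theorem isFreeKhovanskii_onePiLambert (k : ℕ) (x : ℝ) (hk : 1 ≤ k) (hx0 : 0 < x)
    (hx : (k : ℝ) * x * Real.exp x = 1) :
    IsFreeKhovanskii 3 ![(1 : ℂ), Complex.I * Real.pi, (x : ℂ)] := by
  classical
  have hexp1 : Complex.exp (Complex.I * (Real.pi : ℂ)) = -1 := by
    rw [mul_comm]; exact Complex.exp_pi_mul_I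
  have hxC : (k : ℂ) * (x : ℂ) * Complex.exp (x : ℂ) = 1 := by
    rw [← Complex.ofReal_exp]; exact_mod_cast hx
  have hk0 : (k : ℂ) ≠ 0 := by exact_mod_cast (show k ≠ 0 by omega)
  have hx1C : (x : ℂ) + 1 ≠ 0 := by
    have : (x + 1 : ℝ) ≠ 0 := by linarith
    exact_mod_cast this
  refine ⟨![MvPolynomial.X (Sum.inl 0) - 1,
    MvPolynomial.X (Sum.inr 1) + 1,
    MvPolynomial.C (k : ℚ) * MvPolynomial.X (Sum.inl 2) * MvPolynomial.X (Sum.inr 2) - 1], ?_, ?_⟩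
  · intro i
    fin_cases i
    · simp
    · simp [hexp1]
    · simp [hxC]
  · rw [Matrix.det_fin_three]
    simp [Matrix.of_apply, MvPolynomial.pderiv_X, Derivation.leibniz, hexp1]
    intro h
    apply mul_ne_zero (mul_ne_zero hk0 (Complex.exp_ne_zero (x : ℂ))) hx1C
    linear_combination -h

/-- `(1, iπ, x)` is `ℚ`-linearly independent for irrational real `x`: a rational relation
`g₀ + g₁ iπ + g₂ x = 0` has imaginary part `g₁ π = 0`, so `g₁ = 0`; its real part `g₀ + g₂ x = 0`
forces `g₂ = 0` (else `x = −g₀/g₂ ∈ ℚ`) and then `g₀ = 0`. [folklore] -/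
theorem linearIndependent_onePiReal (x : ℝ) (hx : Irrational x) :
    LinearIndependent ℚ ![(1 : ℂ), Complex.I * Real.pi, (x : ℂ)] := by
  rw [Fintype.linearIndependent_iff]
  intro g hg
  simp only [Fin.sum_univ_three, Matrix.cons_val_zero, Matrix.cons_val_one,
    Matrix.cons_val] at hg
  -- imaginary part: `g 1 * π = 0`
  have him := congrArg Complex.im hg
  simp only [Complex.add_im, Complex.zero_im] at him
  have h0 : (g 0 • (1 : ℂ)).im = 0 := by
    rw [Rat.smul_def]; simp
  have h1 : (g 1 • (Complex.I * (Real.pi : ℂ))).im = (g 1 : ℝ) * Real.pi := by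
    rw [Rat.smul_def]; simp
  have h2 : (g 2 • (x : ℂ)).im = 0 := by
    rw [Rat.smul_def, ← Complex.ofReal_ratCast, ← Complex.ofReal_mul, Complex.ofReal_im]
  rw [h0, h1, h2, zero_add, add_zero] at him
  have hg1 : g 1 = 0 := by
    have : ((g 1 : ℚ) : ℝ) = 0 := by
      rcases mul_eq_zero.mp him with h | h
      · exact h
      · exact absurd h Real.pi_ne_zero
    exact_mod_cast this
  -- real part: `g 0 + g 2 * x = 0`
  have hre := congrArg Complex.re hg
  simp only [Complex.add_re, Complex.zero_re] at hre
  have r0 : (g 0 • (1 : ℂ)).re = (g 0 : ℝ) := by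
    rw [Rat.smul_def]; simp
  have r1 : (g 1 • (Complex.I * (Real.pi : ℂ))).re = 0 := by
    rw [Rat.smul_def]; simp
  have r2 : (g 2 • (x : ℂ)).re = (g 2 : ℝ) * x := by
    rw [Rat.smul_def, ← Complex.ofReal_ratCast, ← Complex.ofReal_mul, Complex.ofReal_re]
  rw [r0, r1, r2, add_zero] at hre
  -- if `g 2 ≠ 0` then `x = -g 0 / g 2` would be rational
  have hg2 : g 2 = 0 := by
    by_contra h2ne
    have h2ne' : ((g 2 : ℚ) : ℝ) ≠ 0 := by exact_mod_cast h2ne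
    have hxq : x = ((-(g 0) / g 2 : ℚ) : ℝ) := by
      push_cast
      field_simp
      linarith
    exact hx.ne_rat _ hxq
  have hg0 : g 0 = 0 := by
    have : ((g 0 : ℚ) : ℝ) = 0 := by
      rw [hg2] at hre
      simpa using hre
    exact_mod_cast this
  intro i
  fin_cases i
  · exact hg0
  · exact hg1
  · exact hg2

/-- **STUB 7 (the anchored point).**  `s = (1, iπ, x)`, `k x eˣ = 1`, `k ≥ 1`, `x > 0` irrational, is a
free Khovanskii point of `ℂ³` — system `z₀ − 1`, `y₁ + 1`, `k z₂ y₂ − 1`, exponential Jacobian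
`diag(1, y₁, k y₂ (1 + z₂)) = diag(1, −1, k eˣ (1 + x))` (`Matrix.det_fin_three`, `Complex.exp_pi_mul_I`)
— with `ℚ`-linearly independent coordinates (imaginary part kills the `iπ`-coefficient, then `x ∉ ℚ`).
Assembled from `isFreeKhovanskii_onePiLambert` and `linearIndependent_onePiReal`. [folklore] -/
theorem stub_anchoredPoint :
    ∀ (k : ℕ) (x : ℝ), 1 ≤ k → 0 < x → (k : ℝ) * x * Real.exp x = 1 → Irrational x →
      IsFreeKhovanskii 3 ![(1 : ℂ), Complex.I * Real.pi, (x : ℂ)] ∧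
        LinearIndependent ℚ ![(1 : ℂ), Complex.I * Real.pi, (x : ℂ)] :=
  fun k x hk hx0 hx hirr =>
    ⟨isFreeKhovanskii_onePiLambert k x hk hx0 hx, linearIndependent_onePiReal x hirr⟩

end Summit.Schanuel.Schanuel.Cruxes.KhovanskiiApproxTypeEv.LambertLiouvilleKill

end
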